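import Mathlib
import Literature.NumberTheory.LFunctions.FeketePolynomial
import Literature.RingTheory.Valuation.AlgClosedResidue
import Literature.RingTheory.Valuation.RootReduction

/-!
# `FeketeSOS.FeketeNoSparseSplit` (stmt-ValiantsHypothesis-3997), line `cyclic-valuation-dichotomy` — stub `stub_primitiveReduction`

The vehicle of the line: a complex cyclic splitting `X^p - 1 ∣ A·B - F_p` (`A, B ≠ 0`) of the Fekete
polynomial is reduced at a PLACE OF `ℂ` ABOVE `p`.  Take a valuation subring `V ⊂ ℂ` with `p ∈ 𝔪_V`
(`Literature.RingTheory.Valuation.exists_valuationSubring_natCast_mem_maximalIdeal`, Chevalley), residue field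
`K = V/𝔪_V` of characteristic `p` (`charP_residueField`).  Primitive models `g_A = a·A`, `g_B = b·B ∈ V[X]`
(`exists_model`: `a, b ≠ 0`, reductions `redPoly ≠ 0`) give `g_A g_B = ab·F_p + (X^p - 1)·(ab·Q)` in `ℂ[X]`;
dividing `g_A g_B` by the MONIC `X^p - 1` inside `V[X]` and comparing with this identity (uniqueness of monic
division, `deg F_p < p`) shows that the remainder is `λ·F_p` with `λ = ab ∈ V` (read off at the coefficient
`(1|p) = 1` of `X¹`) and that `ab·Q ∈ V[X]` is the quotient; applying the residue map coefficientwise yields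
`X^p - 1 ∣ ḡ_A·ḡ_B - λ̄·F̄_p` in `K[X]`, with `ḡ_A, ḡ_B ≠ 0` and supports only shrinking.
-/

namespace Summit.ValiantsHypothesis.ValiantsHypothesis.Theorems.FeketeNoSparseSplitCyclic

open Polynomial IsLocalRing
open Literature.NumberTheory.LFunctions
open Literature.RingTheory.Valuation

-- `Summit.ValiantsHypothesis.ValiantsHypothesis.…` is the tree's mandated single-conjunct layout (Sub = Summit).
set_option linter.dupNamespace false

/-- The Fekete polynomial pushed along `ℤ → R → S` is the Fekete polynomial pushed along `ℤ → S`. -/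
theorem pr_map_map_feketePolynomial {R S : Type*} [CommRing R] [CommRing S] (p : ℕ) [Fact p.Prime]
    (f : R →+* S) :
    ((feketePolynomial p).map (Int.castRingHom R)).map f = (feketePolynomial p).map (Int.castRingHom S) := by
  rw [Polynomial.map_map, RingHom.ext_int (f.comp (Int.castRingHom R)) (Int.castRingHom S)]

/-- The coefficient of `X¹` in any reduction of `F_p` is `(1|p) = 1`. -/
theorem pr_coeff_one_map_feketePolynomial (R : Type*) [CommRing R] (p : ℕ) [Fact p.Prime] :
    ((feketePolynomial p).map (Int.castRingHom R)).coeff 1 = 1 := by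
  rw [coeff_map, coeff_feketePolynomial_of_lt p (Fact.out : p.Prime).one_lt, Nat.cast_one,
    legendreSym.at_one, map_one]

/-- `deg F̄_p < p` over any ring. -/
theorem pr_degree_map_feketePolynomial_lt (R : Type*) [CommRing R] (p : ℕ) [Fact p.Prime] :
    ((feketePolynomial p).map (Int.castRingHom R)).degree < p := by
  have hp : 0 < p := (Fact.out : p.Prime).pos
  refine lt_of_le_of_lt (degree_map_le) ?_
  rw [degree_feketePolynomial]
  exact_mod_cast Nat.sub_lt hp one_pos

/-- Multiplying by a non-zero constant does not change the support (over a domain). -/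
theorem pr_support_C_mul {R : Type*} [CommRing R] [IsDomain R] {a : R} (ha : a ≠ 0) (f : R[X]) :
    (C a * f).support = f.support := by
  ext n
  simp only [mem_support_iff, coeff_C_mul, ne_eq, mul_eq_zero, ha, false_or]

/-- **Primitive reduction at a place of `ℂ` above `p`.**  If `A, B ∈ ℂ[X]` are non-zero and
`X^p - 1 ∣ A·B - F_p`, there are a field `K` of characteristic `p`, non-zero `Ā, B̄ ∈ K[X]` with
`supp Ā ⊆ supp A`, `supp B̄ ⊆ supp B`, and `c ∈ K` with `X^p - 1 ∣ Ā·B̄ - c·F̄_p` in `K[X]`. [folklore] -/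
theorem stub_primitiveReduction :
    ∀ (p : ℕ) [Fact p.Prime] (A B : ℂ[X]), A ≠ 0 → B ≠ 0 →
      (X ^ p - 1 : ℂ[X]) ∣ A * B - (feketePolynomial p).map (Int.castRingHom ℂ) →
      ∃ (K : Type) (_ : Field K) (_ : CharP K p) (A' B' : K[X]) (c : K),
        A' ≠ 0 ∧ B' ≠ 0 ∧ A'.support ⊆ A.support ∧ B'.support ⊆ B.support ∧
        (X ^ p - 1 : K[X]) ∣ A' * B' - C c * (feketePolynomial p).map (Int.castRingHom K) := by
  intro p _ A B hA hB hdiv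
  classical
  have hprime : p.Prime := Fact.out
  have hp0 : p ≠ 0 := hprime.ne_zero
  -- a place of ℂ above p and its residue field
  obtain ⟨V, hpV⟩ := exists_valuationSubring_natCast_mem_maximalIdeal (K := ℂ) hprime
  haveI hchar : CharP (ResidueField V) p := charP_residueField V hpV
  set ι : V →+* ℂ := algebraMap V ℂ with hι
  have hιinj : Function.Injective ι := IsFractionRing.injective V ℂ
  set ρ : V →+* ResidueField V := residue V with hρ
  -- primitive models of the two factors
  obtain ⟨a, ha, gA, hgA, hgAr⟩ := exists_model V hA (IsAlgClosed.splits A)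
  obtain ⟨b, hb, gB, hgB, hgBr⟩ := exists_model V hB (IsAlgClosed.splits B)
  -- notation for the Fekete polynomial over the three rings
  set FC : ℂ[X] := (feketePolynomial p).map (Int.castRingHom ℂ) with hFC
  set FV : V[X] := (feketePolynomial p).map (Int.castRingHom V) with hFV
  set FK : (ResidueField V)[X] := (feketePolynomial p).map (Int.castRingHom (ResidueField V)) with hFK
  have hFVC : FV.map ι = FC := pr_map_map_feketePolynomial p ι
  have hFVK : FV.map ρ = FK := pr_map_map_feketePolynomial p ρ
  -- the monic modulus over the three rings
  set MV : V[X] := X ^ p - 1 with hMV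
  have hMVmonic : MV.Monic := by
    rw [hMV, ← C_1]; exact monic_X_pow_sub_C _ hp0
  have hMVC : MV.map ι = X ^ p - 1 := by
    rw [hMV, Polynomial.map_sub, Polynomial.map_pow, map_X, Polynomial.map_one]
  have hMVK : MV.map ρ = X ^ p - 1 := by
    rw [hMV, Polynomial.map_sub, Polynomial.map_pow, map_X, Polynomial.map_one]
  have hMCmonic : ((X : ℂ[X]) ^ p - 1).Monic := by
    rw [← C_1]; exact monic_X_pow_sub_C _ hp0
  -- the product of the models, upstairs
  obtain ⟨Q, hQ⟩ := hdiv
  have hprodC : (gA * gB).map ι = C (a * b) * FC + (X ^ p - 1) * (C (a * b) * Q) := by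
    have h1 : (gA * gB).map ι = C (a * b) * (A * B) := by
      rw [Polynomial.map_mul, hgA, hgB, C_mul]; ring
    have h2 : A * B = FC + (X ^ p - 1) * Q := by
      rw [← hQ]; ring
    rw [h1, h2]; ring
  -- monic division of gA * gB by X^p - 1 inside V[X]
  set r : V[X] := (gA * gB) %ₘ MV with hr
  set q : V[X] := (gA * gB) /ₘ MV with hq
  have hdivV : r + MV * q = gA * gB := modByMonic_add_div (gA * gB) MV
  -- the remainder, seen in ℂ[X], is (ab)·F_p
  have hrC : r.map ι = C (a * b) * FC := by
    rw [hr, map_modByMonic ι hMVmonic, hMVC, hprodC]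
    have hdvd : ((X : ℂ[X]) ^ p - 1) ∣
        (C (a * b) * FC + (X ^ p - 1) * (C (a * b) * Q)) - C (a * b) * FC := by
      refine ⟨C (a * b) * Q, ?_⟩; ring
    rw [modByMonic_eq_of_dvd_sub hMCmonic hdvd]
    refine (modByMonic_eq_self_iff hMCmonic).2 ?_
    have hab : a * b ≠ 0 := mul_ne_zero ha hb
    calc (C (a * b) * FC).degree = FC.degree := degree_C_mul hab
      _ < p := pr_degree_map_feketePolynomial_lt ℂ p
      _ = ((X : ℂ[X]) ^ p - 1).degree := by
          rw [← C_1, degree_X_pow_sub_C hprime.pos]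
  -- hence ab ∈ V: it is the coefficient of X¹ of r
  set lam : V := r.coeff 1 with hlam
  have hlamC : ι lam = a * b := by
    have h := congrArg (fun P : ℂ[X] => P.coeff 1) hrC
    simp only [coeff_map, coeff_C_mul] at h
    rw [hlam, h, hFC, pr_coeff_one_map_feketePolynomial ℂ p, mul_one]
  have hrV : r = C lam * FV := by
    apply Polynomial.map_injective ι hιinj
    rw [hrC, Polynomial.map_mul, map_C, hlamC, hFVC]
  -- the identity gA * gB = λ F_p + (X^p - 1) q in V[X], reduced to the residue field
  have hidV : gA * gB - C lam * FV = MV * q := by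
    rw [← hdivV, hrV]; ring
  refine ⟨ResidueField V, inferInstance, hchar, gA.map ρ, gB.map ρ, ρ lam, ?_, ?_, ?_, ?_, ?_⟩
  · rw [hρ, hgAr]; exact redPoly_ne_zero V A
  · rw [hρ, hgBr]; exact redPoly_ne_zero V B
  · calc (gA.map ρ).support ⊆ gA.support := support_map_subset _ _
      _ = (gA.map ι).support := (support_map_of_injective gA hιinj).symm
      _ = A.support := by rw [hgA, pr_support_C_mul ha]
  · calc (gB.map ρ).support ⊆ gB.support := support_map_subset _ _
      _ = (gB.map ι).support := (support_map_of_injective gB hιinj).symm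
      _ = B.support := by rw [hgB, pr_support_C_mul hb]
  · refine ⟨q.map ρ, ?_⟩
    have h := congrArg (Polynomial.map ρ) hidV
    rw [Polynomial.map_sub, Polynomial.map_mul, Polynomial.map_mul, map_C, hFVK, Polynomial.map_mul,
      hMVK] at h
    rw [← hFK]
    exact h

end Summit.ValiantsHypothesis.ValiantsHypothesis.Theorems.FeketeNoSparseSplitCyclic
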